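import Summits.ValiantsHypothesis.ValiantsHypothesis.Theorems.LacunarySymmetroidMatrixDescartesOverlapRankOneTwo

/-!
# `MatrixDescartes` — the RANK-ONE WINDOW LAW (m = 2): a near-null end letter's window carries at most `K − 2` zeros

HONEST FRAMING.  Object-search cell `pub-symmetroid`, crux `Theses.LacunarySymmetroid.MatrixDescartes` (ledger item
`stmt-ValiantsHypothesis-18050`, route `LacunarySymmetroid`; seat `val-sym-mdr-p2`, gen 13).  The crux implies `VP ≠ VNP`
by the route's assembly; NOTHING here is progress on it, and nothing here is a claim about `VP ≠ VNP`, `DoorA26` /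
`DoorA34` or the cell's registers.  Sequel of `…OverlapRankOneTwo` (`det F = det F_¬t + a·X^(d t)·q_t`) and
`…OverlapWindowCoeff` (`card_roots_Icc_le_coeff`).

THE LAW (`card_roots_Icc_le_of_rankOne_two`).  `F = ∑ₗ X^(d l) • S l`, real 2×2 letters, injective exponents, `S t = a·w wᵀ` of
rank one, `q_t = ∑_{l≠t} c_l X^(d l)` the null compression (`c_l = w⊥ᵀ S l w⊥`).  Choose a surviving letter `l⋆ ≠ t` and cut at
the reals `d t + d l`, `l ∉ {t, l⋆}` (`K − 2` cuts).  If at the two endpoints of `[u, v]` the `|∏(n − α)|`-weighted absolute mass of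
the coefficients of `det F_¬t` — all of them, including the one sitting at the survivor exponent `d t + d l⋆` — is below
`|∏(d t + d l⋆ − α)|·|a·c_{l⋆}|·x^(d t + d l⋆)`, then `det F` has at most `K − 2` distinct zeros in `[u, v]`: the Descartes count
of the compression `q_t` — one window of a rank-one letter over `K − 1` others costs at most `K − 2`, which is the
γ-ladder's external count `γ ≤ (K − 1) − 1` read from above (attained at `K − 1 = 3, 4`).  The hypothesis is the honest price: where `t` dominates in NORM by a factor `Λ`, every coefficient of `det F_¬t` is `O(Λ⁻¹)` relative to
`a·x^(d t)·(other letters)`, so the certificate holds as soon as the compression value `|c_{l⋆}|` is not itself degenerate.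
[folklore] (Laguerre's method + the 2×2 adjugate identity).
-/

-- `Summit.ValiantsHypothesis.ValiantsHypothesis.…` repeats a component by the D-0017 layout (single-conjunct summit).
set_option linter.dupNamespace false

namespace Summit.ValiantsHypothesis.ValiantsHypothesis.Theorems.LacunarySymmetroidMatrixDescartes.Overlap

open Polynomial Finset Set
open scoped BigOperators Matrix

variable {K : ℕ}

/-! ## §18 The rank-one window law -/

/-- **RANK-ONE WINDOW LAW (m = 2).**  See the module docstring.  Cuts: `A = {(d t + d l : ℝ) : l ≠ t, l ≠ l⋆}`; survivor
exponent `d t + d l⋆` with coefficient `coeff(det F_¬t) + a·c_{l⋆}`; certificate at `x = u, v`: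
`∑_{n ∈ supp(det F_¬t), n ≠ d t + d l⋆} |∏(n−α)|·|coeff n|·x^n + |∏(d t + d l⋆ − α)|·|coeff(det F_¬t)(d t + d l⋆)|·x^(d t + d l⋆)
 < |∏(d t + d l⋆ − α)|·|a·c_{l⋆}|·x^(d t + d l⋆)`.  Conclusion: at most `K − 2` distinct zeros of `det F` in `[u, v]`
(for `K ≥ 2`; the cut set has `K − 2` elements). [folklore] -/
theorem card_roots_Icc_le_of_rankOne_two (d : Fin K → ℕ) (hd : Function.Injective d)
    (S : Fin K → Matrix (Fin 2) (Fin 2) ℝ) (t : Fin K) (a : ℝ) (w : Fin 2 → ℝ) (ht : S t = a • Matrix.vecMulVec w w)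
    (lstar : Fin K) (hl : lstar ≠ t) {u v : ℝ} (hu : 0 < u) (huv : u ≤ v)
    (hdom : ∀ x : ℝ, (x = u ∨ x = v) →
      (∑ n ∈ (Matrix.det (∑ l ∈ Finset.univ.erase t, ((X : ℝ[X]) ^ d l) • (S l).map C)).support.filter
          (fun n => n ≠ d t + d lstar),
        |∏ α ∈ ((Finset.univ.erase t).erase lstar).image (fun l : Fin K => ((d t + d l : ℕ) : ℝ)), ((n : ℝ) - α)| *
          |(Matrix.det (∑ l ∈ Finset.univ.erase t, ((X : ℝ[X]) ^ d l) • (S l).map C)).coeff n| * x ^ n)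
      + |∏ α ∈ ((Finset.univ.erase t).erase lstar).image (fun l : Fin K => ((d t + d l : ℕ) : ℝ)),
            (((d t + d lstar : ℕ) : ℝ) - α)| *
          |(Matrix.det (∑ l ∈ Finset.univ.erase t, ((X : ℝ[X]) ^ d l) • (S l).map C)).coeff (d t + d lstar)| *
            x ^ (d t + d lstar)
      < |∏ α ∈ ((Finset.univ.erase t).erase lstar).image (fun l : Fin K => ((d t + d l : ℕ) : ℝ)),
            (((d t + d lstar : ℕ) : ℝ) - α)| *
          |a * (w 1 * w 1 * S lstar 0 0 - w 0 * w 1 * (S lstar 0 1 + S lstar 1 0) + w 0 * w 0 * S lstar 1 1)| *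
            x ^ (d t + d lstar)) :
    ((Matrix.det (∑ l, ((X : ℝ[X]) ^ d l) • (S l).map C)).roots.toFinset.filter
        (fun x => x ∈ Icc u v)).card ≤ K - 2 := by
  classical
  set P : ℝ[X] := Matrix.det (∑ l, ((X : ℝ[X]) ^ d l) • (S l).map C) with hP
  set G : ℝ[X] := Matrix.det (∑ l ∈ Finset.univ.erase t, ((X : ℝ[X]) ^ d l) • (S l).map C) with hG
  set A : Finset ℝ := ((Finset.univ.erase t).erase lstar).image (fun l : Fin K => ((d t + d l : ℕ) : ℝ)) with hA
  set nstar : ℕ := d t + d lstar with hnstar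
  set q : ℝ := a * (w 1 * w 1 * S lstar 0 0 - w 0 * w 1 * (S lstar 0 1 + S lstar 1 0) + w 0 * w 0 * S lstar 1 1)
    with hq
  -- the cut set has `K − 2` elements
  have hinj : Set.InjOn (fun l : Fin K => ((d t + d l : ℕ) : ℝ)) ↑((Finset.univ.erase t).erase lstar) := by
    intro l₁ _ l₂ _ h
    have h' : ((d t + d l₁ : ℕ) : ℝ) = ((d t + d l₂ : ℕ) : ℝ) := h
    have h'' : d t + d l₁ = d t + d l₂ := by exact_mod_cast h'
    exact hd (by omega)
  have hcardA : A.card = K - 2 := by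
    rw [hA, Finset.card_image_of_injOn hinj, Finset.card_erase_of_mem (Finset.mem_erase.2 ⟨hl, Finset.mem_univ _⟩),
      Finset.card_erase_of_mem (Finset.mem_univ t), Finset.card_univ, Fintype.card_fin]
    omega
  rw [← hcardA]
  -- coefficients of `P`: `coeff P n = coeff G n + [n = nstar] q` off the cut exponents
  have hcoeff_star : P.coeff nstar = G.coeff nstar + q := by
    rw [hP, hG, hnstar, hq, coeff_det_pencil_of_rankOne d hd S t a w ht lstar hl]
  have hcoeff_off : ∀ n : ℕ, n ≠ nstar → (n : ℝ) ∉ A → P.coeff n = G.coeff n := by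
    intro n hn hnA
    rw [hP, det_pencil_eq_of_rankOne d S t a w ht, coeff_add, ← hG]
    suffices h0 : (C a * X ^ d t * ∑ l ∈ Finset.univ.erase t,
        C (w 1 * w 1 * S l 0 0 - w 0 * w 1 * (S l 0 1 + S l 1 0) + w 0 * w 0 * S l 1 1) * X ^ (d l)).coeff n = 0 by
      rw [h0, add_zero]
    rw [mul_assoc, coeff_C_mul, Finset.mul_sum, finsetSum_coeff]
    have hzero : ∀ l' ∈ Finset.univ.erase t, (X ^ d t *
        (C (w 1 * w 1 * S l' 0 0 - w 0 * w 1 * (S l' 0 1 + S l' 1 0) + w 0 * w 0 * S l' 1 1) * X ^ (d l'))).coeff n = 0 := by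
      intro l' hl'
      rw [mul_left_comm, ← pow_add, coeff_C_mul_X_pow, if_neg]
      intro heq
      by_cases hls : l' = lstar
      · exact hn (by rw [heq, hls])
      · apply hnA
        rw [hA, Finset.mem_image]
        exact ⟨l', Finset.mem_erase.2 ⟨hls, hl'⟩, by rw [heq]⟩
    rw [Finset.sum_congr rfl hzero, Finset.sum_const_zero, mul_zero]
  -- apply the coefficient-currency rule
  refine card_roots_Icc_le_coeff P A nstar hu huv fun x hx => ?_
  have hx0 : 0 < x := by rcases hx with rfl | rfl; exact hu; exact hu.trans_le huv
  have h := hdom x hx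
  -- the weighted sum over `supp P \\ {nstar}`: cut exponents contribute zero, the rest are coefficients of `G`
  have hsumP : ∑ n ∈ P.support.filter (fun n => n ≠ nstar), |∏ α ∈ A, ((n : ℝ) - α)| * |P.coeff n| * x ^ n ≤
      ∑ n ∈ G.support.filter (fun n => n ≠ nstar), |∏ α ∈ A, ((n : ℝ) - α)| * |G.coeff n| * x ^ n := by
    -- compare termwise on the union of supports
    have hle : ∀ n : ℕ, n ≠ nstar → |∏ α ∈ A, ((n : ℝ) - α)| * |P.coeff n| * x ^ n =
        |∏ α ∈ A, ((n : ℝ) - α)| * |G.coeff n| * x ^ n := by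
      intro n hn
      by_cases hnA : (n : ℝ) ∈ A
      · rw [Finset.prod_eq_zero hnA (sub_self _), abs_zero, zero_mul, zero_mul, zero_mul, zero_mul]
      · rw [hcoeff_off n hn hnA]
    calc ∑ n ∈ P.support.filter (fun n => n ≠ nstar), |∏ α ∈ A, ((n : ℝ) - α)| * |P.coeff n| * x ^ n
        = ∑ n ∈ P.support.filter (fun n => n ≠ nstar), |∏ α ∈ A, ((n : ℝ) - α)| * |G.coeff n| * x ^ n :=
          Finset.sum_congr rfl fun n hn => hle n (Finset.mem_filter.1 hn).2
      _ ≤ ∑ n ∈ (P.support ∪ G.support).filter (fun n => n ≠ nstar), |∏ α ∈ A, ((n : ℝ) - α)| * |G.coeff n| * x ^ n :=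
          Finset.sum_le_sum_of_subset_of_nonneg (Finset.filter_subset_filter _ Finset.subset_union_left)
            (fun n _ _ => mul_nonneg (mul_nonneg (abs_nonneg _) (abs_nonneg _)) (pow_nonneg hx0.le _))
      _ = ∑ n ∈ G.support.filter (fun n => n ≠ nstar), |∏ α ∈ A, ((n : ℝ) - α)| * |G.coeff n| * x ^ n := by
          symm
          refine Finset.sum_subset (Finset.filter_subset_filter _ Finset.subset_union_right) fun n hn hnot => ?_
          rw [Finset.mem_filter] at hn
          have hnG : n ∉ G.support := fun hmem => hnot (Finset.mem_filter.2 ⟨hmem, hn.2⟩)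
          rw [mem_support_iff, not_not] at hnG
          rw [hnG, abs_zero, mul_zero, zero_mul]
  -- survivor: `|coeff P nstar| ≥ |q| − |coeff G nstar|`
  have hsurv : |∏ α ∈ A, ((nstar : ℝ) - α)| * |q| * x ^ nstar - |∏ α ∈ A, ((nstar : ℝ) - α)| * |G.coeff nstar| * x ^ nstar
      ≤ |∏ α ∈ A, ((nstar : ℝ) - α)| * |P.coeff nstar| * x ^ nstar := by
    rw [hcoeff_star, ← sub_mul, ← mul_sub]
    refine mul_le_mul_of_nonneg_right (mul_le_mul_of_nonneg_left ?_ (abs_nonneg _)) (pow_nonneg hx0.le _)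
    have h3 : |q| ≤ |G.coeff nstar + q| + |G.coeff nstar| := by
      have := abs_add_le (G.coeff nstar + q) (-(G.coeff nstar))
      rwa [abs_neg, show G.coeff nstar + q + -G.coeff nstar = q by ring] at this
    linarith
  have hnn : ((nstar : ℕ) : ℝ) = ((d t + d lstar : ℕ) : ℝ) := by rw [hnstar]
  rw [hnn] at hsurv
  linarith [hsumP, hsurv, h]

end Summit.ValiantsHypothesis.ValiantsHypothesis.Theorems.LacunarySymmetroidMatrixDescartes.Overlap
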